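import Summits.Ventures.CertifiedManyBodySolver.Observables.StiffnessApexTransportCurtainTop
import HarnessLib

/-!
# Ventures/CertifiedManyBodySolver — Observables/StiffnessApexTransportCurtainTopLaBoxE.lean

HONEST FRAMING: one-sided certified CEILINGS on the uniform flux stiffness (`t–t′` f-sum class) at half filling, transported into the «La214-E»
box `[−3/10, −1/5] × [29/5, 74/5]` (`n = 1`) from the (E6) curtain — ONE station `29/5` with a SHORT corner-objective overhang + the TOP of the left
edge; a ceiling never speaks to the presence of order; not a `T_c` estimate, not a superconductivity verdict; every leaf is CONDITIONAL on the row
families it names. Zero compute, no definition, no claim node, no `sorry`.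

Cell `pub/hubbard-downfold` (D-0154 (1)(C) COVERAGE, La214 «74/5 insurance», director-hubbard R18: the `74/5` pair and the `U = 8` twins are the
insurance objects), seat `hubbard-cov-la214-unc-2` (`prover-hubbard-cov-la214-unc-2-0`); companion of `Observables/StiffnessApexTransportCurtainTop.lean`
(two-window curtain master, edition (E6), chord form) in the idiom of `Observables/StiffnessApexTransportCurtainLaBoxE.lean` (seat hubbard-downfold-unc-2).

* §5a the (E6) overhang ends of «La214-E» at the window heights `U_L = 6, 13/2, 8, 11`: `−31/100`, `−108/325`, `−153/400`, `−243/550`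
  (`(−3/10)(2 − (29/5)/U_L)`; under (E1) the one overhang reaches `−357/740`);
* §5b generic window height `U_L ≥ 29/5`: `ObsStiffnessSeqCeilingAt_on_laBoxE_of_apexStation29o5_shortOverhang_and_leftEdgeTop` — inner own words on
  `[−3/10, −1/5] × {29/5}`, corner-objective words on `[(−3/10)(2 − (29/5)/U_L), −3/10] × {29/5}`, own words on `{−3/10} × [U_L, 74/5]`;
* §5c THE `U_L = 8` EDITION (family form and THREE-BUNDLE chord form): overhang `[−153/400, −3/10] × {29/5}` with objective `−X₀(−3/10)`, left-top
  `{−3/10} × [8, 74/5]`; bundle vertices `(29/5; −153/400 | −3/10 | −1/5)`, `(8; −3/10)`, `(74/5; −3/10)` — six constants, five certificates, the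
  `(29/5; −3/10)` own-word certificate serving the inner AND the overhang bundle.

Planning arithmetic [float, not of record]: a-priori (kinematic) scale of every source word of (E6) `≤ k(−3/10) = 0.4392` (bar `0.4364687`, 0.6 % below);
the left-top words are the smallest of the box (`U ≥ 8`); an overhang bundle on a LONGER segment (e.g. `[−579/1480, −3/10]`, the GENONLY twin of the (E1)
plan) restricts to `[−153/400, −3/10]` by monotonicity of the hypothesis in the domain.

References: T. Koma, H. Tasaki, J. Stat. Phys. 76 (1994) 745, §1 [KomaTasaki1994]; D. J. Scalapino, S. R. White, S.-C. Zhang, PRB 47 (1993)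
7995, §II [ScalapinoWhiteZhang1993].
-/

noncomputable section

namespace Summit.Ventures.CertifiedManyBodySolver.Observables

open Literature.MathematicalPhysics.QuantumLattice
open Literature.MathematicalPhysics.QuantumLattice.ThermodynamicLimit
open Literature.MathematicalPhysics.QuantumFieldTheory
open Literature.Probability.LatticeModels
open Matrix Finset Filter Topology HubbardWave0
open scoped Matrix BigOperators ComplexOrder

/-! ## §5a The (E6) overhang ends of «La214-E» -/

/-- (E6) overhang end of «La214-E» for the window height `U_L = 8`: `(−3/10)(2 − (29/5)/8) = −153/400` (`= −0.3825`). [folklore] -/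
theorem laBoxE_leftTop8_overhang : (-3 / 10 : ℝ) * (2 - 29 / 5 / 8) = -(153 / 400) := by norm_num

/-- (E6) overhang end of «La214-E» for `U_L = 11`: `(−3/10)(2 − (29/5)/11) = −243/550` (`≈ −0.4418`). [folklore] -/
theorem laBoxE_leftTop11_overhang : (-3 / 10 : ℝ) * (2 - 29 / 5 / 11) = -(243 / 550) := by norm_num

/-- (E6) overhang end of «La214-E» for `U_L = 13/2`: `(−3/10)(2 − (29/5)/(13/2)) = −108/325` (`≈ −0.3323`). [folklore] -/
theorem laBoxE_leftTop13o2_overhang : (-3 / 10 : ℝ) * (2 - 29 / 5 / (13 / 2)) = -(108 / 325) := by norm_num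

/-- (E6) overhang end of «La214-E» for `U_L = 6`: `(−3/10)(2 − (29/5)/6) = −31/100`; the left-top window is then `{−3/10} × [6, 74/5]`. [folklore] -/
theorem laBoxE_leftTop6_overhang : (-3 / 10 : ℝ) * (2 - 29 / 5 / 6) = -(31 / 100) := by norm_num

/-- The four (E6) overhang ends are SHORTER than the (E1) overhang `−357/740` and ordered with the window height:
`−357/740 < −243/550 < −153/400 < −108/325 < −31/100 < −3/10`. [folklore] -/
theorem laBoxE_leftTop_overhangs_ordered :
    (-(357 / 740) : ℝ) < -(243 / 550) ∧ (-(243 / 550) : ℝ) < -(153 / 400) ∧ (-(153 / 400) : ℝ) < -(108 / 325) ∧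
      (-(108 / 325) : ℝ) < -(31 / 100) ∧ (-(31 / 100) : ℝ) < -3 / 10 := by
  refine ⟨?_, ?_, ?_, ?_, ?_⟩ <;> norm_num

/-! ## §5b «La214-E», generic window height -/

section LaBoxE

/-- **«La214-E» (E6), any window height `U_L ≥ 29/5`**: inner own-word family on `[−3/10, −1/5] × {29/5}`, corner-objective (`−X₀(−3/10)`) family on
the short overhang `[(−3/10)(2 − (29/5)/U_L), −3/10] × {29/5}`, own-word family on the left-edge top `{−3/10} × [U_L, 74/5]`, all with `−val ≤ c` ⇒
`ObsStiffnessSeqCeilingAt t′ U 1 c` on the whole box `[−3/10, −1/5] × [29/5, 74/5]`. [cite: KomaTasaki1994, §1] [cite: ScalapinoWhiteZhang1993, §II] -/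
theorem ObsStiffnessSeqCeilingAt_on_laBoxE_of_apexStation29o5_shortOverhang_and_leftEdgeTop (UL : ℝ) (hAL : 29 / 5 ≤ UL)
    (valI valO valL : ℝ → ℝ) (c : ℚ)
    (hI : ∀ s ∈ Set.Icc (-3 / 10 : ℝ) (-1 / 5),
      ∀ (ω : InfVolFermionState 2) (Ls : ℕ → ℕ) (ψ : ∀ L, Fock (Orb (FermionTorus 2 L))),
      Tendsto Ls atTop atTop →
      (∀ j, IsGroundStateInSector (hubbardTorusTT' (Ls j) 1 s (29 / 5)) (rectN 1 (Ls j)) 0 (ψ (Ls j))) →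
      (∀ j, star (ψ (Ls j)) ⬝ᵥ ψ (Ls j) = 1) → ω.IsTorusLimitOf ψ Ls →
      valI s ≤ ((Finset.univ : Finset (DihedralGroup 4)).card : ℝ)⁻¹ * ∑ g ∈ (Finset.univ : Finset (DihedralGroup 4)),
        (ω.expect (d4ShiftSet g 0 (box 2 7)) (fermionEmbed (PolySite.d4Emb g 0 (box 2 7)) (-oddMomentObsTT s (29 / 5) 0))).re)
    (hcI : ∀ s ∈ Set.Icc (-3 / 10 : ℝ) (-1 / 5), -valI s ≤ ((c : ℚ) : ℝ))
    (hO : ∀ s ∈ Set.Icc (-3 / 10 * (2 - 29 / 5 / UL) : ℝ) (-3 / 10),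
      ∀ (ω : InfVolFermionState 2) (Ls : ℕ → ℕ) (ψ : ∀ L, Fock (Orb (FermionTorus 2 L))),
      Tendsto Ls atTop atTop →
      (∀ j, IsGroundStateInSector (hubbardTorusTT' (Ls j) 1 s (29 / 5)) (rectN 1 (Ls j)) 0 (ψ (Ls j))) →
      (∀ j, star (ψ (Ls j)) ⬝ᵥ ψ (Ls j) = 1) → ω.IsTorusLimitOf ψ Ls →
      valO s ≤ ((Finset.univ : Finset (DihedralGroup 4)).card : ℝ)⁻¹ * ∑ g ∈ (Finset.univ : Finset (DihedralGroup 4)),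
        (ω.expect (d4ShiftSet g 0 (box 2 7)) (fermionEmbed (PolySite.d4Emb g 0 (box 2 7)) (-oddMomentObsTT (-3 / 10) (29 / 5) 0))).re)
    (hcO : ∀ s ∈ Set.Icc (-3 / 10 * (2 - 29 / 5 / UL) : ℝ) (-3 / 10), -valO s ≤ ((c : ℚ) : ℝ))
    (hL : ∀ U' ∈ Set.Icc UL (74 / 5),
      ∀ (ω : InfVolFermionState 2) (Ls : ℕ → ℕ) (ψ : ∀ L, Fock (Orb (FermionTorus 2 L))),
      Tendsto Ls atTop atTop →
      (∀ j, IsGroundStateInSector (hubbardTorusTT' (Ls j) 1 (-3 / 10) U') (rectN 1 (Ls j)) 0 (ψ (Ls j))) →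
      (∀ j, star (ψ (Ls j)) ⬝ᵥ ψ (Ls j) = 1) → ω.IsTorusLimitOf ψ Ls →
      valL U' ≤ ((Finset.univ : Finset (DihedralGroup 4)).card : ℝ)⁻¹ * ∑ g ∈ (Finset.univ : Finset (DihedralGroup 4)),
        (ω.expect (d4ShiftSet g 0 (box 2 7)) (fermionEmbed (PolySite.d4Emb g 0 (box 2 7)) (-oddMomentObsTT (-3 / 10) U' 0))).re)
    (hcL : ∀ U' ∈ Set.Icc UL (74 / 5), -valL U' ≤ ((c : ℚ) : ℝ)) :
    ∀ tp ∈ Set.Icc (-3 / 10 : ℝ) (-1 / 5), ∀ U ∈ Set.Icc (29 / 5 : ℝ) (74 / 5), ObsStiffnessSeqCeilingAt tp U 1 c :=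
  ObsStiffnessSeqCeilingAt_halfFilling_on_box_of_apexStation_shortOverhang_and_leftEdgeTop (by norm_num) hAL (by norm_num) (by norm_num)
    valI valO valL c hI hcI hO hcO hL hcL

/-! ## §5c «La214-E», THE `U_L = 8` EDITION: overhang `[−153/400, −3/10] × {29/5}`, left-top `{−3/10} × [8, 74/5]` -/

/-- **«La214-E» (E6) with `U_L = 8`, family form**: inner own-word family on `[−3/10, −1/5] × {29/5}`, corner-objective (`−X₀(−3/10)`) family on
`[−153/400, −3/10] × {29/5}`, own-word family on `{−3/10} × [8, 74/5]`, all with `−val ≤ c` ⇒ `ObsStiffnessSeqCeilingAt t′ U 1 c` on the whole box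
`[−3/10, −1/5] × [29/5, 74/5]`. [cite: KomaTasaki1994, §1] [cite: ScalapinoWhiteZhang1993, §II] -/
theorem ObsStiffnessSeqCeilingAt_on_laBoxE_of_apexStation29o5_shortOverhang153o400_and_leftEdgeTop8 (valI valO valL : ℝ → ℝ) (c : ℚ)
    (hI : ∀ s ∈ Set.Icc (-3 / 10 : ℝ) (-1 / 5),
      ∀ (ω : InfVolFermionState 2) (Ls : ℕ → ℕ) (ψ : ∀ L, Fock (Orb (FermionTorus 2 L))),
      Tendsto Ls atTop atTop →
      (∀ j, IsGroundStateInSector (hubbardTorusTT' (Ls j) 1 s (29 / 5)) (rectN 1 (Ls j)) 0 (ψ (Ls j))) →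
      (∀ j, star (ψ (Ls j)) ⬝ᵥ ψ (Ls j) = 1) → ω.IsTorusLimitOf ψ Ls →
      valI s ≤ ((Finset.univ : Finset (DihedralGroup 4)).card : ℝ)⁻¹ * ∑ g ∈ (Finset.univ : Finset (DihedralGroup 4)),
        (ω.expect (d4ShiftSet g 0 (box 2 7)) (fermionEmbed (PolySite.d4Emb g 0 (box 2 7)) (-oddMomentObsTT s (29 / 5) 0))).re)
    (hcI : ∀ s ∈ Set.Icc (-3 / 10 : ℝ) (-1 / 5), -valI s ≤ ((c : ℚ) : ℝ))
    (hO : ∀ s ∈ Set.Icc (-(153 / 400) : ℝ) (-3 / 10),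
      ∀ (ω : InfVolFermionState 2) (Ls : ℕ → ℕ) (ψ : ∀ L, Fock (Orb (FermionTorus 2 L))),
      Tendsto Ls atTop atTop →
      (∀ j, IsGroundStateInSector (hubbardTorusTT' (Ls j) 1 s (29 / 5)) (rectN 1 (Ls j)) 0 (ψ (Ls j))) →
      (∀ j, star (ψ (Ls j)) ⬝ᵥ ψ (Ls j) = 1) → ω.IsTorusLimitOf ψ Ls →
      valO s ≤ ((Finset.univ : Finset (DihedralGroup 4)).card : ℝ)⁻¹ * ∑ g ∈ (Finset.univ : Finset (DihedralGroup 4)),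
        (ω.expect (d4ShiftSet g 0 (box 2 7)) (fermionEmbed (PolySite.d4Emb g 0 (box 2 7)) (-oddMomentObsTT (-3 / 10) (29 / 5) 0))).re)
    (hcO : ∀ s ∈ Set.Icc (-(153 / 400) : ℝ) (-3 / 10), -valO s ≤ ((c : ℚ) : ℝ))
    (hL : ∀ U' ∈ Set.Icc (8 : ℝ) (74 / 5),
      ∀ (ω : InfVolFermionState 2) (Ls : ℕ → ℕ) (ψ : ∀ L, Fock (Orb (FermionTorus 2 L))),
      Tendsto Ls atTop atTop →
      (∀ j, IsGroundStateInSector (hubbardTorusTT' (Ls j) 1 (-3 / 10) U') (rectN 1 (Ls j)) 0 (ψ (Ls j))) →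
      (∀ j, star (ψ (Ls j)) ⬝ᵥ ψ (Ls j) = 1) → ω.IsTorusLimitOf ψ Ls →
      valL U' ≤ ((Finset.univ : Finset (DihedralGroup 4)).card : ℝ)⁻¹ * ∑ g ∈ (Finset.univ : Finset (DihedralGroup 4)),
        (ω.expect (d4ShiftSet g 0 (box 2 7)) (fermionEmbed (PolySite.d4Emb g 0 (box 2 7)) (-oddMomentObsTT (-3 / 10) U' 0))).re)
    (hcL : ∀ U' ∈ Set.Icc (8 : ℝ) (74 / 5), -valL U' ≤ ((c : ℚ) : ℝ)) :
    ∀ tp ∈ Set.Icc (-3 / 10 : ℝ) (-1 / 5), ∀ U ∈ Set.Icc (29 / 5 : ℝ) (74 / 5), ObsStiffnessSeqCeilingAt tp U 1 c := by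
  refine ObsStiffnessSeqCeilingAt_on_laBoxE_of_apexStation29o5_shortOverhang_and_leftEdgeTop 8 (by norm_num) valI valO valL c hI hcI
    (fun s hs => ?_) (fun s hs => ?_) hL hcL
  · rw [laBoxE_leftTop8_overhang] at hs; exact hO s hs
  · rw [laBoxE_leftTop8_overhang] at hs; exact hcO s hs

/-- **«La214-E» (E6) with `U_L = 8` from THREE BUNDLES, six vertex constants.** INNER bundle on `[−3/10, −1/5] × {29/5}`: the chord of the own-word
vertex constants `vI₁` (at `−3/10`) and `vI₂` (at `−1/5`); SHORT OVERHANG bundle on `[−153/400, −3/10] × {29/5}`: the chord of `vO₁` (at `−153/400`) and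
`vO₂` (at `−3/10`) for the CONSTANT objective `−X₀(−3/10)`; LEFT-TOP bundle on `{−3/10} × [8, 74/5]`: the chord IN `U` of the own-word vertex constants `vL₁`
(at `U = 8`) and `vL₂` (at `U = 74/5`); `c ≥ −vI₁, −vI₂, −vO₁, −vO₂, −vL₁, −vL₂`. Then `ObsStiffnessSeqCeilingAt t′ U 1 c` on the whole box
`[−3/10, −1/5] × [29/5, 74/5]`. [cite: KomaTasaki1994, §1] [cite: ScalapinoWhiteZhang1993, §II] -/
theorem ObsStiffnessSeqCeilingAt_on_laBoxE_of_apexStation29o5_innerChord_shortOverhangChord153o400_and_leftEdgeTop8Chord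
    (vI₁ vI₂ vO₁ vO₂ vL₁ vL₂ : ℝ) (c : ℚ)
    (hcI₁ : -vI₁ ≤ ((c : ℚ) : ℝ)) (hcI₂ : -vI₂ ≤ ((c : ℚ) : ℝ)) (hcO₁ : -vO₁ ≤ ((c : ℚ) : ℝ)) (hcO₂ : -vO₂ ≤ ((c : ℚ) : ℝ))
    (hcL₁ : -vL₁ ≤ ((c : ℚ) : ℝ)) (hcL₂ : -vL₂ ≤ ((c : ℚ) : ℝ))
    (hInner : ∀ s ∈ Set.Icc (-3 / 10 : ℝ) (-1 / 5),
      ∀ (ω : InfVolFermionState 2) (Ls : ℕ → ℕ) (ψ : ∀ L, Fock (Orb (FermionTorus 2 L))),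
      Tendsto Ls atTop atTop →
      (∀ j, IsGroundStateInSector (hubbardTorusTT' (Ls j) 1 s (29 / 5)) (rectN 1 (Ls j)) 0 (ψ (Ls j))) →
      (∀ j, star (ψ (Ls j)) ⬝ᵥ ψ (Ls j) = 1) → ω.IsTorusLimitOf ψ Ls →
      (-1 / 5 - s) / (-1 / 5 - -3 / 10) * vI₁ + (s - -3 / 10) / (-1 / 5 - -3 / 10) * vI₂ ≤
        ((Finset.univ : Finset (DihedralGroup 4)).card : ℝ)⁻¹ * ∑ g ∈ (Finset.univ : Finset (DihedralGroup 4)),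
          (ω.expect (d4ShiftSet g 0 (box 2 7)) (fermionEmbed (PolySite.d4Emb g 0 (box 2 7)) (-oddMomentObsTT s (29 / 5) 0))).re)
    (hOverhang : ∀ s ∈ Set.Icc (-(153 / 400) : ℝ) (-3 / 10),
      ∀ (ω : InfVolFermionState 2) (Ls : ℕ → ℕ) (ψ : ∀ L, Fock (Orb (FermionTorus 2 L))),
      Tendsto Ls atTop atTop →
      (∀ j, IsGroundStateInSector (hubbardTorusTT' (Ls j) 1 s (29 / 5)) (rectN 1 (Ls j)) 0 (ψ (Ls j))) →
      (∀ j, star (ψ (Ls j)) ⬝ᵥ ψ (Ls j) = 1) → ω.IsTorusLimitOf ψ Ls →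
      (-3 / 10 - s) / (-3 / 10 - -(153 / 400)) * vO₁ + (s - -(153 / 400)) / (-3 / 10 - -(153 / 400)) * vO₂ ≤
        ((Finset.univ : Finset (DihedralGroup 4)).card : ℝ)⁻¹ * ∑ g ∈ (Finset.univ : Finset (DihedralGroup 4)),
          (ω.expect (d4ShiftSet g 0 (box 2 7)) (fermionEmbed (PolySite.d4Emb g 0 (box 2 7)) (-oddMomentObsTT (-3 / 10) (29 / 5) 0))).re)
    (hLeftTop : ∀ U' ∈ Set.Icc (8 : ℝ) (74 / 5),
      ∀ (ω : InfVolFermionState 2) (Ls : ℕ → ℕ) (ψ : ∀ L, Fock (Orb (FermionTorus 2 L))),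
      Tendsto Ls atTop atTop →
      (∀ j, IsGroundStateInSector (hubbardTorusTT' (Ls j) 1 (-3 / 10) U') (rectN 1 (Ls j)) 0 (ψ (Ls j))) →
      (∀ j, star (ψ (Ls j)) ⬝ᵥ ψ (Ls j) = 1) → ω.IsTorusLimitOf ψ Ls →
      (74 / 5 - U') / (74 / 5 - 8) * vL₁ + (U' - 8) / (74 / 5 - 8) * vL₂ ≤
        ((Finset.univ : Finset (DihedralGroup 4)).card : ℝ)⁻¹ * ∑ g ∈ (Finset.univ : Finset (DihedralGroup 4)),
          (ω.expect (d4ShiftSet g 0 (box 2 7)) (fermionEmbed (PolySite.d4Emb g 0 (box 2 7)) (-oddMomentObsTT (-3 / 10) U' 0))).re) :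
    ∀ tp ∈ Set.Icc (-3 / 10 : ℝ) (-1 / 5), ∀ U ∈ Set.Icc (29 / 5 : ℝ) (74 / 5), ObsStiffnessSeqCeilingAt tp U 1 c := by
  refine ObsStiffnessSeqCeilingAt_on_laBoxE_of_apexStation29o5_shortOverhang153o400_and_leftEdgeTop8
    (fun s => (-1 / 5 - s) / (-1 / 5 - -3 / 10) * vI₁ + (s - -3 / 10) / (-1 / 5 - -3 / 10) * vI₂)
    (fun s => (-3 / 10 - s) / (-3 / 10 - -(153 / 400)) * vO₁ + (s - -(153 / 400)) / (-3 / 10 - -(153 / 400)) * vO₂)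
    (fun U' => (74 / 5 - U') / (74 / 5 - 8) * vL₁ + (U' - 8) / (74 / 5 - 8) * vL₂) c hInner (fun s hs => ?_) hOverhang
    (fun s hs => ?_) hLeftTop (fun U' hU' => ?_)
  · obtain ⟨hl₁, hl₂, hsum, -, -⟩ := tPrimeSegment_weights (by norm_num : (-3 / 10 : ℝ) < -1 / 5) hs.1 hs.2
    have hmin := min_le_chord_of_weights (c₁ := vI₁) (c₂ := vI₂) hl₁ hl₂ hsum
    have hneg : -min vI₁ vI₂ ≤ ((c : ℚ) : ℝ) := by
      rcases le_total vI₁ vI₂ with hv | hv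
      · rw [min_eq_left hv]; exact hcI₁
      · rw [min_eq_right hv]; exact hcI₂
    linarith
  · obtain ⟨hl₁, hl₂, hsum, -, -⟩ := tPrimeSegment_weights (by norm_num : (-(153 / 400) : ℝ) < -3 / 10) hs.1 hs.2
    have hmin := min_le_chord_of_weights (c₁ := vO₁) (c₂ := vO₂) hl₁ hl₂ hsum
    have hneg : -min vO₁ vO₂ ≤ ((c : ℚ) : ℝ) := by
      rcases le_total vO₁ vO₂ with hv | hv
      · rw [min_eq_left hv]; exact hcO₁
      · rw [min_eq_right hv]; exact hcO₂
    linarith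
  · obtain ⟨hl₁, hl₂, hsum, -, -⟩ := tPrimeSegment_weights (by norm_num : (8 : ℝ) < 74 / 5) hU'.1 hU'.2
    have hmin := min_le_chord_of_weights (c₁ := vL₁) (c₂ := vL₂) hl₁ hl₂ hsum
    have hneg : -min vL₁ vL₂ ≤ ((c : ℚ) : ℝ) := by
      rcases le_total vL₁ vL₂ with hv | hv
      · rw [min_eq_left hv]; exact hcL₁
      · rw [min_eq_right hv]; exact hcL₂
    linarith

end LaBoxE

end Summit.Ventures.CertifiedManyBodySolver.Observables

end
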